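import Summits.ValiantsHypothesis.ValiantsHypothesis.Theorems.LacunarySymmetroidMatrixDescartesIndexOneDetSign
import Summits.ValiantsHypothesis.ValiantsHypothesis.Theorems.LacunarySymmetroidMatrixDescartesIndexOneNodeType

/-!
# `MatrixDescartes` (stmt-ValiantsHypothesis-18050) — pivot column at index one: the g23 structure theorems IN THE CURRENCY OF
# `Pivot.PivotRootLawAt m K 1 B` (width-one `W` with `J + W Wᵀ ⪰ 0`)

HONEST FRAMING.  Cell `pub-symmetroid`, seat `val-sym-mdr-p2` (gen 23); helper file `--supports` the crux
`Theses.LacunarySymmetroid.MatrixDescartes` (OPEN), NO closure claim.  Pure glue: restates this seat's index-one structure theorems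
(p677643 `…IndexOneInflection`, p678011 `…IndexOnePsdAtRoots`, p678654 `…IndexOneWronskianForm`, p679023 `…IndexOneNodeType`, p679122
`…IndexOneDetSign`) with the hypotheses exactly as they occur inside conjb-1's row `Pivot.PivotRootLawAt m K 1 B` (`…CensusPivotDefs`):
`J.IsSymm`, `∀ k, (P k).PosSemidef`, a width-one matrix `W : Matrix (Fin m) (Fin 1) ℝ` with `(J + W * Wᵀ).PosSemidef`; plus the
non-degeneracy `(J + W * Wᵀ + ∑ P k).PosDef` of the skeleton sum (its failure is the degenerate corner: a common kernel vector of all letters).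
So a successor proving «`posRootCount 𝔖 ≤ B − 2` for every such datum» closes `PivotRootLawAt m K 1 B` by `pivotRootLawAt_of_dent_bound`.
Nothing here bears on `MatrixDescartes` in its window, on `stub_twoSided`, on `DoorA26` / `DoorA34`, the census registers, or `VP ≠ VNP`.

[folklore] Bookkeeping only.  Axioms `propext`, `Classical.choice`, `Quot.sound`.
-/

set_option linter.dupNamespace false

namespace Summit.ValiantsHypothesis.ValiantsHypothesis.Theorems.LacunarySymmetroidMatrixDescartes.SecularRolle

open Polynomial Matrix Finset
open scoped BigOperators

variable {m K : ℕ}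

local notation3 (prettyPrint := false) "𝔻[" e ", " d ", " A ", " P "]" =>
  ((X : ℝ[X]) ^ (e : ℕ)) • (A : Matrix (Fin _) (Fin _) ℝ).map Polynomial.C
    + ∑ k, ((X : ℝ[X]) ^ (d : Fin _ → ℕ) k) • ((P : Fin _ → Matrix (Fin _) (Fin _) ℝ) k).map Polynomial.C

local notation3 (prettyPrint := false) "𝕔[" w "]" => (fun i => Polynomial.C ((w : Fin _ → ℝ) i))

local notation3 (prettyPrint := false) "𝔖[" N ", " D "]" =>
  (X : ℝ[X]) * (twistedWronskian 0 N D * derivative (N * D) - derivative (twistedWronskian 0 N D) * (N * D))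

/-- The column of a width-one matrix (local notation): `col W = W · 0`. -/
local notation3 (prettyPrint := false) "col[" W "]" => (fun i => (W : Matrix (Fin _) (Fin 1) ℝ) i 0)

/-- `J + W Wᵀ = J + w wᵀ` with `w = col W`. [bookkeeping] -/
theorem add_mul_transpose_width_one (J : Matrix (Fin m) (Fin m) ℝ) (W : Matrix (Fin m) (Fin 1) ℝ) :
    J + W * Wᵀ = J + vecMulVec col[W] col[W] := by
  rw [mul_transpose_width_one]

/-- **THE INFLECTION BOUND IN PIVOT CURRENCY.**  For the data of `PivotRootLawAt m K 1 B` (`Pₖ ⪰ 0`, `J + W Wᵀ ⪰ 0` with `W` of width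
one) with non-degenerate skeleton `J + W Wᵀ + ∑ Pₖ ≻ 0` and `W ≠ 0`:
`pivotPosRoots e d J P ≤ Z₊(𝔖[N, det 𝔻]) + 2`, where `𝔻 = X^e (J + W Wᵀ) + ∑ X^{dₖ} Pₖ`, `N = wᵀ adj(𝔻) w`, `w = col W`. [folklore] -/
theorem pivotPosRoots_le_dent_add_two_of_width_one (e : ℕ) (d : Fin K → ℕ) {J : Matrix (Fin m) (Fin m) ℝ}
    {P : Fin K → Matrix (Fin m) (Fin m) ℝ} (hP : ∀ k, (P k).PosSemidef) (W : Matrix (Fin m) (Fin 1) ℝ)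
    (hW : (J + W * Wᵀ).PosSemidef) (hpd : (J + W * Wᵀ + ∑ k, P k).PosDef) (hW0 : col[W] ≠ 0) :
    Pivot.pivotPosRoots e d J P
      ≤ posRootCount 𝔖[(𝕔[col[W]] ⬝ᵥ ((𝔻[e, d, (J + vecMulVec col[W] col[W]), P]).adjugate *ᵥ 𝕔[col[W]])),
          Matrix.det (𝔻[e, d, (J + vecMulVec col[W] col[W]), P])] + 2 := by
  rw [add_mul_transpose_width_one] at hW hpd
  obtain ⟨hD, hN⟩ := skeleton_hypotheses e d hW hP hpd hW0
  exact pivotPosRoots_le_dent_add_two e d J P col[W] hD hN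

/-- **A row of the pivot column from a dent bound** (the successor's entry point): if for every `(e, d, J, P, W)` as above with
non-degenerate skeleton and `W ≠ 0` the dent discriminant has `≤ B − 2` positive zeros (`B ≥ 2`), and the degenerate data (`W = 0` or singular
skeleton sum) satisfy the row by other means (hypothesis `hdeg`), then `PivotRootLawAt m K 1 B`. [bookkeeping] -/
theorem pivotRootLawAt_of_dent_bound {B : ℕ} (hB : 2 ≤ B)
    (hdent : ∀ (e : ℕ) (d : Fin K → ℕ) (J : Matrix (Fin m) (Fin m) ℝ) (P : Fin K → Matrix (Fin m) (Fin m) ℝ)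
      (W : Matrix (Fin m) (Fin 1) ℝ), J.IsSymm → (∀ k, (P k).PosSemidef) → (J + W * Wᵀ).PosSemidef →
      (J + W * Wᵀ + ∑ k, P k).PosDef → col[W] ≠ 0 →
      posRootCount 𝔖[(𝕔[col[W]] ⬝ᵥ ((𝔻[e, d, (J + vecMulVec col[W] col[W]), P]).adjugate *ᵥ 𝕔[col[W]])),
          Matrix.det (𝔻[e, d, (J + vecMulVec col[W] col[W]), P])] ≤ B - 2)
    (hdeg : ∀ (e : ℕ) (d : Fin K → ℕ) (J : Matrix (Fin m) (Fin m) ℝ) (P : Fin K → Matrix (Fin m) (Fin m) ℝ)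
      (W : Matrix (Fin m) (Fin 1) ℝ), J.IsSymm → (∀ k, (P k).PosSemidef) → (J + W * Wᵀ).PosSemidef →
      (¬ (J + W * Wᵀ + ∑ k, P k).PosDef ∨ col[W] = 0) → Pivot.pivotPosRoots e d J P ≤ B) :
    Pivot.PivotRootLawAt m K 1 B := by
  intro e d J P hJ hP hex
  obtain ⟨W, hW⟩ := hex
  by_cases hpd : (J + W * Wᵀ + ∑ k, P k).PosDef
  · by_cases hW0 : col[W] = 0
    · exact hdeg e d J P W hJ hP hW (Or.inr hW0)
    · have h := pivotPosRoots_le_dent_add_two_of_width_one e d hP W hW hpd hW0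
      have h2 := hdent e d J P W hJ hP hW hpd hW0
      omega
  · exact hdeg e d J P W hJ hP hW (Or.inl hpd)

/-- **PSD AT ROOTS IN PIVOT CURRENCY**: data of `PivotRootLawAt m K 1 B`, non-degenerate skeleton, `x > 0` a root of `det F` ⇒ `F(x) ⪰ 0`;
and `F(x) ⪰ 0 ⟺ 0 ≤ det F(x)` in general (p678011, p679122). [folklore] -/
theorem pivot_posSemidef_iff_det_nonneg_of_width_one (e : ℕ) (d : Fin K → ℕ) {J : Matrix (Fin m) (Fin m) ℝ}
    {P : Fin K → Matrix (Fin m) (Fin m) ℝ} (hP : ∀ k, (P k).PosSemidef) (W : Matrix (Fin m) (Fin 1) ℝ)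
    (hW : (J + W * Wᵀ).PosSemidef) (hpd : (J + W * Wᵀ + ∑ k, P k).PosDef) {x : ℝ} (hx : 0 < x) :
    (x ^ e • J + ∑ k, x ^ d k • P k).PosSemidef ↔ 0 ≤ (x ^ e • J + ∑ k, x ^ d k • P k).det := by
  rw [add_mul_transpose_width_one] at hW hpd
  exact pivot_posSemidef_iff_det_nonneg e d hW hP hpd hx

/-- **ONE-SIDED ⇒ ONE-SIGNED WRONSKIAN IN PIVOT CURRENCY** (p678654): with `A = J + W Wᵀ`, `w = col W`, all `dₖ ≥ e` ⇒ `W_e(x) ≤ 0`,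
all `dₖ ≤ e` ⇒ `W_e(x) ≥ 0`, for every `x > 0`. [folklore] -/
theorem twistedWronskian_sign_of_oneSided (e : ℕ) (d : Fin K → ℕ) {J : Matrix (Fin m) (Fin m) ℝ} (hJ : J.IsSymm)
    {P : Fin K → Matrix (Fin m) (Fin m) ℝ} (hP : ∀ k, (P k).PosSemidef) (W : Matrix (Fin m) (Fin 1) ℝ) {x : ℝ} (hx : 0 < x) :
    ((∀ k, e ≤ d k) →
      (twistedWronskian e (𝕔[col[W]] ⬝ᵥ ((𝔻[e, d, (J + vecMulVec col[W] col[W]), P]).adjugate *ᵥ 𝕔[col[W]]))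
        (Matrix.det (𝔻[e, d, (J + vecMulVec col[W] col[W]), P]))).eval x ≤ 0)
    ∧ ((∀ k, d k ≤ e) →
      0 ≤ (twistedWronskian e (𝕔[col[W]] ⬝ᵥ ((𝔻[e, d, (J + vecMulVec col[W] col[W]), P]).adjugate *ᵥ 𝕔[col[W]]))
        (Matrix.det (𝔻[e, d, (J + vecMulVec col[W] col[W]), P]))).eval x) := by
  have hA : (J + vecMulVec col[W] col[W]).IsSymm := by
    have hv : (vecMulVec col[W] col[W]).IsSymm := by
      unfold Matrix.IsSymm; ext i j; simp [vecMulVec_apply, mul_comm]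
    exact hJ.add hv
  exact ⟨fun hd => twistedWronskian_nonpos_of_le e d col[W] hA hP hd hx,
    fun hd => twistedWronskian_nonneg_of_ge e d col[W] hA hP hd hx⟩

end Summit.ValiantsHypothesis.ValiantsHypothesis.Theorems.LacunarySymmetroidMatrixDescartes.SecularRolle
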